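import Summits.BirchSwinnertonDyer.BirchSwinnertonDyer.Theorems.GenusKolyvaginAtTwoPowDvdShaCardAtTwoRTStrictSupply
import Summits.BirchSwinnertonDyer.BirchSwinnertonDyer.Theorems.GenusKolyvaginAtTwoPowDvdShaCardAtTwoRTRelaxedRung
import Literature.NumberTheory.EllipticCurves.SelmerProofs
import HarnessLib

/-!
# Route `GenusKolyvaginAtTwo`, crux L_T `PowDvdShaCardAtTwoRT` (stmt-BirchSwinnertonDyer-23242), LINE 18 `plus_descent`,
# stub 3a⁗ `stub_twinExhibitionGenus` — TOOLBOX, steps (c)+(d) IN SELMER CURRENCY: the whole ladder from a supply in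
# `Sel^{(p^M)}(E/K)`, and from a RELAXED supply with the genus INDEX as budget

Seat `bsd-line-gk2-p2` g15 (PROVER seat 2/3, cell `bsd-f1-sign2`), `--supports 23242 --as helper`. THEOREMS ONLY (no
definition, no named fact, no `sorry`). BSD is not proved by any of this; neither is the crux.

The ladder files of this seat (`SymplecticModulesLadder`, `…RTShaLadder`, `…RTStrictSupply`) speak of classes in `Ш(E/K)[p^∞]`
or in `H¹(K, E)`; the line's other seats (gk2-p3's genus budget `relIndex_selmerGroup_relaxed_le_…`, gk2-p1 g14's
`…RTRelaxedRung`) and McCallum's Prop. 5.2 speak of classes in `H¹(K, E[p^M])` and its Selmer group. This file is the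
dictionary, so that the ONLY remaining hypothesis of 3a⁗'s count is a supply statement about `Sel^{(p^M)}(E/K)` (resp. a
relaxed Selmer group and its index):

* §1 `exists_addEquiv_selmerGroup_primaryComponent_sha` — **`Sel^{(p^M)}(E/K) ≃ Ш(E/K)[p^∞]`** (compatible with
  `H¹(K,E[p^M]) → H¹(K,E)`) when `E(K)` is `p^M`-divisible (gk2-p1 g14 `torsionH1ToH1_injective_of_divisible`: Kummer) and
  `p^M` kills `Ш(E/K)[p^∞]` (Silverman X.4.2(a), tree `map_torsionH1ToH1_selmerGroup_holds`): rank `0` + `p ∤ #E(K)_tors` +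
  `M` large.
* §2 `pow_dvd_natCard_primaryComponent_sha_of_selmer_avoidance` — **the ladder in Selmer currency**: if for each `j < k`
  every `s ⊆ Sel^{(p^M)}` with `#s ≤ 2j` is avoided by a Selmer class `z` with `p^{a_j} ∣ ord z`, then
  `p^{2 Σ a_j} ∣ #Ш(E/K)[p^∞]` (this seat's `pow_two_mul_sum_dvd_natCard_of_avoidance_of_injective` through §1).
* §3 `pow_dvd_natCard_primaryComponent_sha_of_relaxed_selmer_supply` — **the loss-free ladder from a RELAXED supply with the
  INDEX as budget**: `Sel ≤ R ≤ H¹(K, E[p^M])` with `0 < [R : Sel] ≤ h`; if for each `j < k` every `s ⊆ H¹(K,E[p^M])` with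
  `#s ≤ 2j + (h − 1)` is avoided by some `z ∈ R` with `p^{a_j} ∣ ord z`, then `p^{2 Σ a_j} ∣ #Ш(E/K)[p^∞]` — the pigeonhole
  repair (`exists_sub_strict_of_relaxed_supply`) with `π : H¹ → H¹/Sel`, `F = R/Sel` (`#F = [R : Sel]`). With gk2-p3's
  `[res⁻¹ Sel(W_K) : Sel(W)] ≤ 2^{ord₂ C(Wd)}` this is literally «Prop. 5.2 over `ℚ` at `2`, relaxed at `d_K`, with
  `2^{ord₂ C(Wd)} − 1` spare generators ⟹ `2·Σ a_j ≤ ord₂ #Ш(E/ℚ)[2^∞]`»; on the `ord₂ C(Wd) = 1` rows ONE spare generator.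

References: [McCallumLMS1991] §5 Prop. 5.2, p. 310; [SilvermanAEC2009] VIII.§2, X.4.2; [Kramer1981] Thm. 1.
-/

noncomputable section

-- `Summit.<P>.<Sub>` repeats `BirchSwinnertonDyer` by the tree's layout convention (D-0017)
set_option linter.dupNamespace false

open scoped Classical

namespace Summit.BirchSwinnertonDyer.BirchSwinnertonDyer.Theorems.GenusExact.PlusDescent

open _root_.WeierstrassCurve AddSubgroup NumberField Literature.NumberTheory.EllipticCurves
open Literature.GroupTheory.FiniteAbelian
open Summit.BirchSwinnertonDyer.BirchSwinnertonDyer.Theorems.GenusExact.CasselsTateNumberField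

/-! ## §0 Index bookkeeping (pure algebra) -/

section Index

variable {A : Type*} [AddCommGroup A]

/-- The image of `R` in `A ⧸ S` has `[R : S ∩ R]` elements: `#(R.map (A → A/S)) = S.relIndex R`. [folklore] -/
theorem natCard_map_mk'_eq_relIndex (S R : AddSubgroup A) :
    Nat.card (R.map (QuotientAddGroup.mk' S)) = S.relIndex R := by
  set f : R →+ A ⧸ S := (QuotientAddGroup.mk' S).comp R.subtype with hf
  have hker : f.ker = S.addSubgroupOf R := by
    ext x
    rw [AddMonoidHom.mem_ker, hf, AddMonoidHom.comp_apply, coe_subtype, QuotientAddGroup.mk'_apply,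
      QuotientAddGroup.eq_zero_iff, AddSubgroup.mem_addSubgroupOf]
  have hrange : f.range = R.map (QuotientAddGroup.mk' S) := by
    rw [hf, AddMonoidHom.range_comp, AddSubgroup.range_subtype]
  rw [← hrange, ← Nat.card_congr (QuotientAddGroup.quotientKerEquivRange f).toEquiv, hker,
    ← AddSubgroup.index_eq_card]
  rfl

end Index

/-! ## §1 `Sel^{(p^M)}(E/K) ≃ Ш(E/K)[p^∞]` -/

section Dictionary

variable {K : Type} [Field K] [NumberField K] (V : WeierstrassCurve K) [V.IsElliptic] (p : ℕ) [hp : Fact p.Prime]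

/-- **`Sel^{(p^M)}(E/K) ≃ Ш(E/K)[p^∞]`, compatibly with `H¹(K, E[p^M]) → H¹(K, E)`**, when `E(K) = p^M·E(K)` (so that
`H¹(K,E[p^M]) → H¹(K,E)` is injective — gk2-p1 `torsionH1ToH1_injective_of_divisible`, Kummer) and `p^M • Ш(E/K)[p^∞] = 0`
(so that `Ш[p^∞] ⊆ Ш[p^M]` = the image of the Selmer group, Silverman X.4.2(a) `map_torsionH1ToH1_selmerGroup_holds`).
[cite: SilvermanAEC2009, Thm. X.4.2(a)] -/
theorem exists_addEquiv_selmerGroup_primaryComponent_sha (M : ℕ)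
    (hdivK : ∀ P : V.toAffine.Point, ∃ Q : V.toAffine.Point, ((p ^ M : ℕ) : ℤ) • Q = P)
    (hexp : ∀ y : AddCommGroup.primaryComponent V.sha p, p ^ M • y = 0) :
    ∃ e : selmerGroup V ((p ^ M : ℕ) : ℤ) ≃+ AddCommGroup.primaryComponent V.sha p,
      ∀ x, (((e x : AddCommGroup.primaryComponent V.sha p) : V.sha) : V.galH1) =
        torsionH1ToH1 V ((p ^ M : ℕ) : ℤ) x := by
  set n : ℤ := ((p ^ M : ℕ) : ℤ) with hn_def
  have hn : n ≠ 0 := by rw [hn_def]; exact_mod_cast pow_ne_zero M hp.out.ne_zero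
  have hmap : (selmerGroup V n).map (torsionH1ToH1 V n) = V.sha ⊓ AddSubgroup.torsionBy V.galH1 n :=
    WeierstrassCurve.map_torsionH1ToH1_selmerGroup_holds V hn
  -- the map `Sel → Ш[p^∞]`
  have hsha : ∀ x : selmerGroup V n, torsionH1ToH1 V n x ∈ V.sha := fun x ↦
    torsionH1ToH1_mem_sha_of_mem_selmerGroup V hn x.2
  have htor : ∀ x : selmerGroup V n, n • torsionH1ToH1 V n x = 0 := fun x ↦ by
    have hx : torsionH1ToH1 V n x ∈ (selmerGroup V n).map (torsionH1ToH1 V n) :=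
      AddSubgroup.mem_map_of_mem _ x.2
    rw [hmap] at hx
    exact mem_torsionBy_iff.mp hx.2
  have hpc : ∀ x : selmerGroup V n,
      (⟨torsionH1ToH1 V n x, hsha x⟩ : V.sha) ∈ AddCommGroup.primaryComponent V.sha p := fun x ↦ by
    refine AddCommGroup.mem_primaryComponent.mpr ⟨M, Subtype.ext ?_⟩
    rw [AddSubgroupClass.coe_nsmul, ZeroMemClass.coe_zero, ← natCast_zsmul]
    exact htor x
  let f : selmerGroup V n →+ AddCommGroup.primaryComponent V.sha p :=
    { toFun := fun x ↦ ⟨⟨torsionH1ToH1 V n x, hsha x⟩, hpc x⟩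
      map_zero' := by ext; simp
      map_add' := fun x y ↦ by ext; simp }
  have hf : ∀ x, (((f x : AddCommGroup.primaryComponent V.sha p) : V.sha) : V.galH1) = torsionH1ToH1 V n x :=
    fun _ ↦ rfl
  have hinj : Function.Injective f := by
    intro x y hxy
    apply Subtype.ext
    apply torsionH1ToH1_injective_of_divisible V hn hdivK
    have h := congrArg (fun z : AddCommGroup.primaryComponent V.sha p ↦ ((z : V.sha) : V.galH1)) hxy
    simpa only [hf] using h
  have hsurj : Function.Surjective f := by
    intro y
    have hy : ((y : V.sha) : V.galH1) ∈ V.sha ⊓ AddSubgroup.torsionBy V.galH1 n := by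
      refine ⟨(y : V.sha).2, mem_torsionBy_iff.mpr ?_⟩
      have h1 : (p ^ M) • ((y : V.sha) : V.galH1) =
          (((p ^ M • y : AddCommGroup.primaryComponent V.sha p) : V.sha) : V.galH1) := by
        simp only [AddSubgroupClass.coe_nsmul]
      rw [hn_def, natCast_zsmul, h1, hexp y]
      rfl
    rw [← hmap] at hy
    obtain ⟨x, hx, hxy⟩ := AddSubgroup.mem_map.mp hy
    refine ⟨⟨x, hx⟩, Subtype.ext (Subtype.ext ?_)⟩
    rw [hf]
    exact hxy
  exact ⟨AddEquiv.ofBijective f ⟨hinj, hsurj⟩, fun x ↦ hf x⟩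

/-! ## §2 The ladder in Selmer currency -/

/-- **The avoidance ladder in `Ш(E/K)[p^∞]` from a supply in `Sel^{(p^M)}(E/K)`** (any number field `K`, any prime `p`; `E(K)`
`p^M`-divisible, `p^M • Ш(E/K)[p^∞] = 0`, `Ш(E/K)[p^∞]` finite). If for every `j < k` every finite `s ⊆ Sel^{(p^M)}(E/K)` with
`#s ≤ 2j` is avoided (`⟨z⟩ ∩ ⟨s⟩ = 0`) by some Selmer class `z` with `p^{a_j} ∣ ord z`, then `p^{2(a₀ + ⋯ + a_{k-1})} ∣ #Ш(E/K)[p^∞]`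
— McCallum's "simple induction" (`SymplecticModulesLadder`) read through §1. [cite: McCallumLMS1991, §5 p. 310] -/
theorem pow_dvd_natCard_primaryComponent_sha_of_selmer_avoidance
    [Finite (AddCommGroup.primaryComponent V.sha p)] (M : ℕ)
    (hdivK : ∀ P : V.toAffine.Point, ∃ Q : V.toAffine.Point, ((p ^ M : ℕ) : ℤ) • Q = P)
    (hexp : ∀ y : AddCommGroup.primaryComponent V.sha p, p ^ M • y = 0) (k : ℕ) (a : ℕ → ℕ)
    (havoid : ∀ j < k, ∀ s : Finset (galH1Torsion V ((p ^ M : ℕ) : ℤ)),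
      (↑s : Set (galH1Torsion V ((p ^ M : ℕ) : ℤ))) ⊆ selmerGroup V ((p ^ M : ℕ) : ℤ) → s.card ≤ 2 * j →
      ∃ z ∈ selmerGroup V ((p ^ M : ℕ) : ℤ), p ^ a j ∣ addOrderOf z ∧
        Disjoint (zmultiples z) (closure (s : Set (galH1Torsion V ((p ^ M : ℕ) : ℤ))))) :
    p ^ (2 * ∑ j ∈ Finset.range k, a j) ∣ Nat.card (AddCommGroup.primaryComponent V.sha p) := by
  obtain ⟨B, halt, hnd⟩ := exists_nondegenerate_alternating_pairing_primaryComponent_sha V p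
  obtain ⟨e, -⟩ := exists_addEquiv_selmerGroup_primaryComponent_sha V p M hdivK hexp
  set ι : AddCommGroup.primaryComponent V.sha p →+ galH1Torsion V ((p ^ M : ℕ) : ℤ) :=
    (selmerGroup V ((p ^ M : ℕ) : ℤ)).subtype.comp e.symm.toAddMonoidHom with hι_def
  have hι : Function.Injective ι := (AddSubgroup.subtype_injective _).comp e.symm.injective
  have hrange : ι.range = selmerGroup V ((p ^ M : ℕ) : ℤ) := by
    have htop : e.symm.toAddMonoidHom.range = ⊤ :=
      AddMonoidHom.range_eq_top.mpr fun y ↦ ⟨e y, e.symm_apply_apply y⟩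
    rw [hι_def, AddMonoidHom.range_comp, htop, ← AddMonoidHom.range_eq_map, AddSubgroup.range_subtype]
  refine pow_two_mul_sum_dvd_natCard_of_avoidance_of_injective B halt hnd ι hι p k (fun _ ↦ 1) a
    (fun _ _ ↦ one_ne_zero) ?_
  intro j hj s hs hcard
  rw [hrange] at hs
  obtain ⟨z, hz, hdvd, hdisj⟩ := havoid j hj s hs hcard
  refine ⟨z, ?_, ?_, hdisj⟩
  · simpa only [one_mul] using hdvd
  · rw [one_smul, hrange]; exact hz

/-- The same in valuation form: `2(a₀ + ⋯ + a_{k-1}) ≤ ord_p #Ш(E/K)[p^∞]`. [cite: McCallumLMS1991, §5 p. 310] -/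
theorem two_mul_sum_le_padicValNat_natCard_primaryComponent_sha_of_selmer_avoidance
    [Finite (AddCommGroup.primaryComponent V.sha p)] (M : ℕ)
    (hdivK : ∀ P : V.toAffine.Point, ∃ Q : V.toAffine.Point, ((p ^ M : ℕ) : ℤ) • Q = P)
    (hexp : ∀ y : AddCommGroup.primaryComponent V.sha p, p ^ M • y = 0) (k : ℕ) (a : ℕ → ℕ)
    (havoid : ∀ j < k, ∀ s : Finset (galH1Torsion V ((p ^ M : ℕ) : ℤ)),
      (↑s : Set (galH1Torsion V ((p ^ M : ℕ) : ℤ))) ⊆ selmerGroup V ((p ^ M : ℕ) : ℤ) → s.card ≤ 2 * j →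
      ∃ z ∈ selmerGroup V ((p ^ M : ℕ) : ℤ), p ^ a j ∣ addOrderOf z ∧
        Disjoint (zmultiples z) (closure (s : Set (galH1Torsion V ((p ^ M : ℕ) : ℤ))))) :
    2 * ∑ j ∈ Finset.range k, a j ≤ padicValNat p (Nat.card (AddCommGroup.primaryComponent V.sha p)) := by
  rw [← padicValNat_dvd_iff_le (Nat.card_pos (α := AddCommGroup.primaryComponent V.sha p)).ne']
  exact pow_dvd_natCard_primaryComponent_sha_of_selmer_avoidance V p M hdivK hexp k a havoid

/-! ## §3 The loss-free ladder from a RELAXED supply, the index `[R : Sel]` as budget -/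

/-- **The loss-free ladder from a relaxed supply with the index as budget.** `E(K)` `p^M`-divisible, `p^M • Ш(E/K)[p^∞] = 0`,
`Ш(E/K)[p^∞]` finite; `R ≤ H¹(K, E[p^M])` any subgroup with `0 < [R : Sel ∩ R] ≤ h` (the RELAXED classes, `Sel ≤ R` in practice;
on the LINE 18 frame `R = res⁻¹(Sel^{(2^M)}(E_K/K))` and `h = 2^{ord₂ C(Wd)}`, gk2-p3
`relIndex_selmerGroup_comap_resTorsion_le_two_pow_padicValNat_tamagawaProduct_twin_of_Δ_neg`). If for every `j < k` every finite
`s ⊆ H¹(K, E[p^M])` with `#s ≤ 2j + (h − 1)` is avoided by some `z ∈ R` with `p^{a_j} ∣ ord z` — McCallum's Prop. 5.2 shape with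
`h − 1` SPARE generators — then `p^{2(a₀ + ⋯ + a_{k-1})} ∣ #Ш(E/K)[p^∞]`: the pigeonhole repair
(`exists_sub_strict_of_relaxed_supply` with `π : H¹ → H¹/Sel`, `F = R/Sel`) makes each rung STRICT at no cost in order, and §2
counts. [cite: McCallumLMS1991, §5 Prop. 5.2 and p. 310] -/
theorem pow_dvd_natCard_primaryComponent_sha_of_relaxed_selmer_supply
    [Finite (AddCommGroup.primaryComponent V.sha p)] (M : ℕ)
    (hdivK : ∀ P : V.toAffine.Point, ∃ Q : V.toAffine.Point, ((p ^ M : ℕ) : ℤ) • Q = P)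
    (hexp : ∀ y : AddCommGroup.primaryComponent V.sha p, p ^ M • y = 0)
    (R : AddSubgroup (galH1Torsion V ((p ^ M : ℕ) : ℤ))) {h : ℕ}
    (hidx : (selmerGroup V ((p ^ M : ℕ) : ℤ)).relIndex R ≤ h)
    (hidx0 : (selmerGroup V ((p ^ M : ℕ) : ℤ)).relIndex R ≠ 0) (k : ℕ) (a : ℕ → ℕ)
    (hsupply : ∀ j < k, ∀ s : Finset (galH1Torsion V ((p ^ M : ℕ) : ℤ)), s.card ≤ 2 * j + (h - 1) →
      ∃ z ∈ R, p ^ a j ∣ addOrderOf z ∧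
        Disjoint (zmultiples z) (closure (s : Set (galH1Torsion V ((p ^ M : ℕ) : ℤ))))) :
    p ^ (2 * ∑ j ∈ Finset.range k, a j) ∣ Nat.card (AddCommGroup.primaryComponent V.sha p) := by
  classical
  set S : AddSubgroup (galH1Torsion V ((p ^ M : ℕ) : ℤ)) := selmerGroup V ((p ^ M : ℕ) : ℤ) with hS_def
  set π : galH1Torsion V ((p ^ M : ℕ) : ℤ) →+ galH1Torsion V ((p ^ M : ℕ) : ℤ) ⧸ S := QuotientAddGroup.mk' S
    with hπ_def
  -- the defect set `F = π(R) = R/Sel`, of `[R : Sel]` elements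
  have hcardI : Nat.card (R.map π) = S.relIndex R := natCard_map_mk'_eq_relIndex S R
  haveI hfinI : Finite (R.map π) := Nat.finite_of_card_ne_zero (hcardI ▸ hidx0)
  have hIfin : ((R.map π : AddSubgroup _) : Set (galH1Torsion V ((p ^ M : ℕ) : ℤ) ⧸ S)).Finite :=
    Set.toFinite _
  set F : Finset (galH1Torsion V ((p ^ M : ℕ) : ℤ) ⧸ S) := hIfin.toFinset with hF_def
  have hmemF : ∀ z ∈ R, π z ∈ F := fun z hz ↦ by
    rw [hF_def, Set.Finite.mem_toFinset]
    exact AddSubgroup.mem_map_of_mem π hz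
  have hFcard : F.card = S.relIndex R := by
    rw [← hcardI]
    exact (Nat.card_eq_card_finite_toFinset hIfin).symm
  have h0F : (0 : galH1Torsion V ((p ^ M : ℕ) : ℤ) ⧸ S) ∈ F := by
    rw [← map_zero π]; exact hmemF 0 R.zero_mem
  have hFerase : (F.erase 0).card ≤ h - 1 := by
    rw [Finset.card_erase_of_mem h0F, hFcard]
    exact Nat.sub_le_sub_right hidx 1
  -- strict supply by the pigeonhole repair, then §2
  refine pow_dvd_natCard_primaryComponent_sha_of_selmer_avoidance V p M hdivK hexp k a fun j hj s _ hcard ↦ ?_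
  have hsup' : ∀ s' : Finset (galH1Torsion V ((p ^ M : ℕ) : ℤ)), s'.card ≤ 2 * j + (F.erase 0).card →
      ∃ z ∈ R, p ^ a j ∣ addOrderOf z ∧ π z ∈ F ∧
        Disjoint (zmultiples z) (closure (s' : Set (galH1Torsion V ((p ^ M : ℕ) : ℤ)))) := by
    intro s' hs'
    obtain ⟨z, hzR, hdvd, hdisj⟩ := hsupply j hj s' (by omega)
    exact ⟨z, hzR, hdvd, hmemF z hzR, hdisj⟩
  obtain ⟨z, -, hdvd, hπz, hdisj⟩ :=
    exists_sub_strict_of_relaxed_supply R π F (p ^ a j) (2 * j + (F.erase 0).card) hsup' s (by omega)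
  refine ⟨z, ?_, hdvd, hdisj⟩
  rw [hπ_def, QuotientAddGroup.mk'_apply, QuotientAddGroup.eq_zero_iff] at hπz
  exact hπz

/-- The same in valuation form: `2(a₀ + ⋯ + a_{k-1}) ≤ ord_p #Ш(E/K)[p^∞]`. [cite: McCallumLMS1991, §5 Prop. 5.2 and p. 310] -/
theorem two_mul_sum_le_padicValNat_natCard_primaryComponent_sha_of_relaxed_selmer_supply
    [Finite (AddCommGroup.primaryComponent V.sha p)] (M : ℕ)
    (hdivK : ∀ P : V.toAffine.Point, ∃ Q : V.toAffine.Point, ((p ^ M : ℕ) : ℤ) • Q = P)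
    (hexp : ∀ y : AddCommGroup.primaryComponent V.sha p, p ^ M • y = 0)
    (R : AddSubgroup (galH1Torsion V ((p ^ M : ℕ) : ℤ))) {h : ℕ}
    (hidx : (selmerGroup V ((p ^ M : ℕ) : ℤ)).relIndex R ≤ h)
    (hidx0 : (selmerGroup V ((p ^ M : ℕ) : ℤ)).relIndex R ≠ 0) (k : ℕ) (a : ℕ → ℕ)
    (hsupply : ∀ j < k, ∀ s : Finset (galH1Torsion V ((p ^ M : ℕ) : ℤ)), s.card ≤ 2 * j + (h - 1) →
      ∃ z ∈ R, p ^ a j ∣ addOrderOf z ∧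
        Disjoint (zmultiples z) (closure (s : Set (galH1Torsion V ((p ^ M : ℕ) : ℤ))))) :
    2 * ∑ j ∈ Finset.range k, a j ≤ padicValNat p (Nat.card (AddCommGroup.primaryComponent V.sha p)) := by
  rw [← padicValNat_dvd_iff_le (Nat.card_pos (α := AddCommGroup.primaryComponent V.sha p)).ne']
  exact pow_dvd_natCard_primaryComponent_sha_of_relaxed_selmer_supply V p M hdivK hexp R hidx hidx0 k a hsupply

end Dictionary

/-! ## §4 The LINE 18 frame over `ℚ`: 3a⁗'s rank-zero side reduced to ONE supply statement -/

section Frame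

variable (W : WeierstrassCurve ℚ) [W.IsElliptic] [W.IsGloballyMinimal] {K : Type} [Field K] [NumberField K]

/-- **RANK-ZERO SIDE OF 3a⁗, ALL RUNGS, LOSS-FREE UP TO THE GENUS INDEX AS AVOIDANCE BUDGET.** `W/ℚ` globally minimal elliptic
with `C(W)` odd, `K` imaginary quadratic with odd `d_K` and the Heegner hypothesis for `N_W`, `Wd = Cd • W^{(d_K)}` any model of the
twin, `rank E(ℚ) = 0`, `#E(ℚ)_tors` odd, `Ш(E/ℚ)[2^∞]` finite and killed by `2^M`, and the `d_K`-relaxed `2^M`-Selmer group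
`R = res⁻¹(Sel^(2^M)(E_K/K)) ⊓ ⨅_∞` of finite index over `Sel^(2^M)(E/ℚ)` (`hm0`). SUPPLY (the one hypothesis the 3a⁗ reader
owes — McCallum's Prop. 5.2 over `ℚ` at `2` for the descended odd-depth classes): for every `j < k`, every finite
`s ⊆ H¹(ℚ, E[2^M])` with `#s ≤ 2j + (2^{ord₂ C(Wd)} − 1)` is avoided by some `z ∈ R` with `2^{a_j} ∣ ord z`. CONCLUSION:
**`2·(a₀ + ⋯ + a_{k-1}) ≤ ord₂ #Ш(E/ℚ)[2^∞]`** — §3 with gk2-p3's budget `[R : Sel] ≤ 2^{ord₂ C(Wd)}`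
(`relIndex_selmerGroup_relaxed_le_two_pow_padicValNat_tamagawaProduct_twin`) and gk2-p1's divisibility
(`exists_zsmul_two_pow_eq_of_rank_zero_of_odd_torsionOrder`). On the rows `ord₂ C(Wd) = 1` the spare budget is ONE generator.
[cite: McCallumLMS1991, §5 Prop. 5.2 and p. 310] [cite: Kramer1981, §2 Prop. 3 and Thm. 1] -/
theorem two_mul_sum_le_padicValNat_sha_of_relaxed_supply_heegner (hK : IsImaginaryQuadratic K)
    (hodd : Odd (NumberField.discr K)) (hH : SatisfiesHeegnerHypothesis (W.conductorNorm ℤ) K)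
    (hT : Odd W.tamagawaProduct) {Wd : WeierstrassCurve ℚ} [Wd.IsElliptic] (Cd : VariableChange ℚ)
    (hWd : Cd • W.quadraticTwist (NumberField.discr K : ℚ) = Wd)
    (hrk : W.mordellWeilRank = 0) (htor : Odd W.torsionOrder)
    [Finite (AddCommGroup.primaryComponent W.sha 2)] (M : ℕ)
    (hexp : ∀ y : AddCommGroup.primaryComponent W.sha 2, 2 ^ M • y = 0)
    (hm0 : (selmerGroup W ((2 ^ M : ℕ) : ℤ)).relIndex
      ((selmerGroup (W.baseChange K) ((2 ^ M : ℕ) : ℤ)).comap (resTorsion W K ((2 ^ M : ℕ) : ℤ)) ⊓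
        ⨅ w : InfinitePlace ℚ, selmerLocalKer W w.Completion ((2 ^ M : ℕ) : ℤ)) ≠ 0)
    (k : ℕ) (a : ℕ → ℕ)
    (hsupply : ∀ j < k, ∀ s : Finset (galH1Torsion W ((2 ^ M : ℕ) : ℤ)),
      s.card ≤ 2 * j + (2 ^ padicValNat 2 Wd.tamagawaProduct - 1) →
      ∃ z ∈ (selmerGroup (W.baseChange K) ((2 ^ M : ℕ) : ℤ)).comap (resTorsion W K ((2 ^ M : ℕ) : ℤ)) ⊓
          ⨅ w : InfinitePlace ℚ, selmerLocalKer W w.Completion ((2 ^ M : ℕ) : ℤ),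
        2 ^ a j ∣ addOrderOf z ∧
        Disjoint (zmultiples z) (closure (s : Set (galH1Torsion W ((2 ^ M : ℕ) : ℤ))))) :
    2 * ∑ j ∈ Finset.range k, a j ≤ padicValNat 2 (Nat.card (AddCommGroup.primaryComponent W.sha 2)) := by
  haveI : Fact (Nat.Prime 2) := ⟨Nat.prime_two⟩
  exact two_mul_sum_le_padicValNat_natCard_primaryComponent_sha_of_relaxed_selmer_supply W 2 M
    (exists_zsmul_two_pow_eq_of_rank_zero_of_odd_torsionOrder W hrk htor M) hexp _
    (relIndex_selmerGroup_relaxed_le_two_pow_padicValNat_tamagawaProduct_twin W hK hodd hH hT Cd hWd _) hm0 k a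
    hsupply

end Frame

/-! ## §5 (append) Choosing the level: `p^{#Ш[p^∞]}` kills `Ш[p^∞]`, so a supply at EVERY large level suffices -/

section Level

variable {K : Type} [Field K] [NumberField K] (V : WeierstrassCurve K) [V.IsElliptic] (p : ℕ) [hp : Fact p.Prime]

omit [V.IsElliptic] in
/-- Every element of the finite group `Ш(E/K)[p^∞]` is killed by `p^{#Ш(E/K)[p^∞]}` (its order is a power `p^j` dividing the
cardinality, and `j < p^j`). [folklore] -/
theorem pow_natCard_nsmul_eq_zero_primaryComponent_sha [Finite (AddCommGroup.primaryComponent V.sha p)]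
    (y : AddCommGroup.primaryComponent V.sha p) :
    p ^ Nat.card (AddCommGroup.primaryComponent V.sha p) • y = 0 := by
  obtain ⟨j, hj⟩ := (AddCommGroup.mem_primaryComponent_iff_addOrderOf (G := V.sha) (p := p)).mp y.2
  have hy : addOrderOf y = p ^ j := by rw [← hj, addOrderOf_mk]
  have hdvd : p ^ j ∣ Nat.card (AddCommGroup.primaryComponent V.sha p) := hy ▸ addOrderOf_dvd_natCard y
  have hjle : j ≤ Nat.card (AddCommGroup.primaryComponent V.sha p) :=
    ((Nat.lt_pow_self hp.out.one_lt).le).trans (Nat.le_of_dvd Nat.card_pos hdvd)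
  exact addOrderOf_dvd_iff_nsmul_eq_zero.mp (hy ▸ pow_dvd_pow p hjle)

omit [V.IsElliptic] in
/-- Hence `p^M • Ш(E/K)[p^∞] = 0` for every `M ≥ #Ш(E/K)[p^∞]`. [folklore] -/
theorem pow_nsmul_eq_zero_primaryComponent_sha_of_le [Finite (AddCommGroup.primaryComponent V.sha p)] {M : ℕ}
    (hM : Nat.card (AddCommGroup.primaryComponent V.sha p) ≤ M) (y : AddCommGroup.primaryComponent V.sha p) :
    p ^ M • y = 0 := by
  rw [← Nat.sub_add_cancel hM, pow_add, mul_smul, pow_natCard_nsmul_eq_zero_primaryComponent_sha V p y, smul_zero]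

end Level

section FrameLevel

variable (W : WeierstrassCurve ℚ) [W.IsElliptic] [W.IsGloballyMinimal] {K : Type} [Field K] [NumberField K]

/-- **RANK-ZERO SIDE OF 3a⁗ FROM A SUPPLY AT EVERY LARGE LEVEL** (the shape McCallum's Prop. 5.2 delivers: "Let `M > M_r`. There
exists `n ∈ S_r(M)` …"). Same frame as `two_mul_sum_le_padicValNat_sha_of_relaxed_supply_heegner`, but the level is not fixed:
the relaxed `2^M`-Selmer group has finite index for every `M` (`hm0`), and for every `M ≥ M₁` the relaxed supply with
`2^{ord₂ C(Wd)} − 1` spare generators holds at level `M`. Then `2·(a₀ + ⋯ + a_{k-1}) ≤ ord₂ #Ш(E/ℚ)[2^∞]` — the level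
`M = max(M₁, #Ш(E/ℚ)[2^∞])` kills `Ш[2^∞]` (`pow_nsmul_eq_zero_primaryComponent_sha_of_le`).
[cite: McCallumLMS1991, §5 Prop. 5.2 and p. 310] -/
theorem two_mul_sum_le_padicValNat_sha_of_forall_relaxed_supply_heegner (hK : IsImaginaryQuadratic K)
    (hodd : Odd (NumberField.discr K)) (hH : SatisfiesHeegnerHypothesis (W.conductorNorm ℤ) K)
    (hT : Odd W.tamagawaProduct) {Wd : WeierstrassCurve ℚ} [Wd.IsElliptic] (Cd : VariableChange ℚ)
    (hWd : Cd • W.quadraticTwist (NumberField.discr K : ℚ) = Wd)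
    (hrk : W.mordellWeilRank = 0) (htor : Odd W.torsionOrder)
    [Finite (AddCommGroup.primaryComponent W.sha 2)]
    (hm0 : ∀ M : ℕ, (selmerGroup W ((2 ^ M : ℕ) : ℤ)).relIndex
      ((selmerGroup (W.baseChange K) ((2 ^ M : ℕ) : ℤ)).comap (resTorsion W K ((2 ^ M : ℕ) : ℤ)) ⊓
        ⨅ w : InfinitePlace ℚ, selmerLocalKer W w.Completion ((2 ^ M : ℕ) : ℤ)) ≠ 0)
    (M₁ k : ℕ) (a : ℕ → ℕ)
    (hsupply : ∀ M : ℕ, M₁ ≤ M → ∀ j < k, ∀ s : Finset (galH1Torsion W ((2 ^ M : ℕ) : ℤ)),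
      s.card ≤ 2 * j + (2 ^ padicValNat 2 Wd.tamagawaProduct - 1) →
      ∃ z ∈ (selmerGroup (W.baseChange K) ((2 ^ M : ℕ) : ℤ)).comap (resTorsion W K ((2 ^ M : ℕ) : ℤ)) ⊓
          ⨅ w : InfinitePlace ℚ, selmerLocalKer W w.Completion ((2 ^ M : ℕ) : ℤ),
        2 ^ a j ∣ addOrderOf z ∧
        Disjoint (zmultiples z) (closure (s : Set (galH1Torsion W ((2 ^ M : ℕ) : ℤ))))) :
    2 * ∑ j ∈ Finset.range k, a j ≤ padicValNat 2 (Nat.card (AddCommGroup.primaryComponent W.sha 2)) := by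
  haveI : Fact (Nat.Prime 2) := ⟨Nat.prime_two⟩
  set M : ℕ := max M₁ (Nat.card (AddCommGroup.primaryComponent W.sha 2)) with hM_def
  exact two_mul_sum_le_padicValNat_sha_of_relaxed_supply_heegner W hK hodd hH hT Cd hWd hrk htor M
    (pow_nsmul_eq_zero_primaryComponent_sha_of_le W 2 (le_max_right _ _)) (hm0 M) k a
    (hsupply M (le_max_left _ _))

end FrameLevel

end Summit.BirchSwinnertonDyer.BirchSwinnertonDyer.Theorems.GenusExact.PlusDescent

end
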